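import Literature.MathematicalPhysics.QuantumFieldTheory.Balaban1983to89.B12Eq18Current
import Literature.MathematicalPhysics.QuantumFieldTheory.Balaban1983to89.B9Eq370Expansion
import Literature.MathematicalPhysics.QuantumFieldTheory.Balaban1983to89.B9Eq336CurrentBound
import Literature.MathematicalPhysics.QuantumFieldTheory.Balaban1983to89.B12Eq338CondIV

/-!
# `Balaban1983to89.B12Eq311CurrentExpansion` — T. Bałaban, *Renormalization group approach to lattice gauge field theories. I*,
Commun. Math. Phys. **109** (1987) 249–301 [Balaban1987RG1], p. 272: the substitution (3.10) `U′ = exp iξ𝐀·U`, the expansion (3.11)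
of the current (1.8) `J(exp iξ𝐀·U) = J(U) + D^{ξ*}_U π D^ξ_U 𝐀 + 𝐅(U, 𝐀)` (file 1 of 4: THE OBJECTS — the current with the projection
`π` on the abstract lattice of [15], the four fluctuation letters of a plaquette and the EXACT second-order expansion
`Im U′(∂p) − Im U(∂p) − ξ²(D^ξ_U𝐀)(p) = q₂ + r₃`, (3.11) as an identity with `𝐅` := the remainder, the torus dictionary, and the
scaling identity (3.12))

statement-level skeleton of published theorems with citation tags; proofs where landed; nothing here is a claim about the Yang–Mills mass gap

PDF held: `paper:balaban1987-cmp109-rg-i-small-field` (journal page = PDF page + 248), p. 272 [PDF 24] read from the text layer; the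
printed PROOF ROUTE is [14] = T. Bałaban, *Spaces of regular gauge field configurations on a lattice and gauge fixing conditions*, CMP
**99** (1985) 75–102 [Balaban1985RegularSpaces], (1.43)–(1.54) pp. 83–85 (held, PDF = journal − 74, pp. 9–12 read), carried out on the carrier of
[15] = [Balaban1985BackgroundPropagators] as formalised by the tree (`B9Eq39Adjoint`: sites `S`, directions `ι`, shifts
`T μ : S ≃ S`, bond units `U : ι → S → 𝔸ˣ`, `R(W)X = WXW⁻¹`, `covD`, `covDstar`, `curl`, `plaqU`, `divP`, `divPη`,
`prodCfg U ξ A = (b ↦ e^{iξA(b)}U(b))`; `B9Eq37Insertion`: `imC`, `holonomy`, `rem`, `quad`, `commSum`; `B9Eq369Product`: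
`plaqU_prodCfg_val`; `B9Eq370Expansion`: `covDstar_prodCfg`, `conjRem`) and, through the `rfl`-dictionary of `B12Eq18Current`
(`dirForm`, `torusT`, `plaq_eq_plaqU`), on the torus carriers of `B12RegularSpaces111` / `Setup`.

THE PRINT, verbatim (p. 272): *«Let us consider more generally the function 𝐄^{(j)}(X, exp iξ𝐀U_{k+1}). It is obtained from the
analytic function 𝐄^{(j)}(X, 𝐔′, 𝐉′) by the substitution  𝐔′ = exp iξ𝐀U_{k+1}, 𝐉′ = D^{ξ*}_{exp iξ𝐀U_{k+1}} ξ⁻²π Im ∂ exp iξ𝐀U_{k+1}.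
(3.10)  We expand the expression on the right-hand side above with respect to 𝐀 using the formulas (1.43)–(1.54) [14]. We obtain
more generally, for any regular configuration U  D^{ξ*}_{exp iξ𝐀U} ξ⁻²π Im ∂ exp iξ𝐀U = D^{ξ*}_U ξ⁻²π Im ∂U + D^{ξ*}_U D^ξ_U 𝐀 + 𝐅(U, 𝐀),
(3.11)  where 𝐅 is a local operator depending on U, ∂U, 𝐀, ∇^ξ_U𝐀 only. … Consider now the formula (3.11) for U = U_{k+1}. We have
D^{ξ*}_{U_{k+1}} ξ⁻²π Im ∂U_{k+1} = (L^{j−1}η)³J_{k+1}, (3.12)»*; [14] p. 85: *«This is the basic estimate.»* (1.54):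
*«D^{η*}_{U₁U₀}∂U₁U₀ = D^{η*}_{U₀}∂U₀ + iη²D^{η*}_{U₀}D^η_{U₀}A + O₁(36dα₂(Lʲη)⁻¹|∇^η_{U₀}A|η²) + O₁(50dα₂³(Lʲη)⁻³η²) + O₁(10dα₀α₂(Lʲη)⁻³η²)»*
p. 85: *«we use these factors to cancel η⁻¹»*.

WHAT IS REPRODUCED.  SKELETON row `B12.Eq3.10-3.12` (owner cell r09 `ROWS-B12.md`: «PARTIAL: J-argument membership bound
`B12Membership313J.jArg_norm_lt/jArg_lt` (schematic); the identity (3.11) ([14] (1.43)–(1.54)) and the Landau replacement ((180) [15])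
are not typed (INTERFACES I-r09-1)»; `B12Membership313J` header (b): «The bound on 𝐅₁ is the one genuinely un-displayed input … NOT
derived here (that would require the explicit (1.43)–(1.54) [14] expansion behind (3.11))»).  Cell `lit-balaban`, unit `lit-balaban-p07`
(Phase-2 proof seat p07 gen 7, `literature-prover-lit-balaban-p07-g7-0`; TAKING line HOME/STATUS.md 2026-08-21T11:03:09Z), HOME
`run/shared/lean/pub/lit-balaban/`.  FOUR FILES: `B12Eq311CurrentExpansion` (objects, (3.10), (3.11) as identity, (3.12)),
`B12Eq311PlaquetteBounds` (one plaquette), `B12Eq311LatticeBounds` (covariant differences, the three terms), `B12Eq311RemainderBound`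
(the bound on 𝐅, its linear form `‖𝐅‖ ≤ (d−1)·Cπ·C_F(ρ)·α₂`).

THIS FILE.  §1 `Gπ`/`Jπ`/`lapπ`/`F311`, `eq311` (definitional).  §2 one plaquette: `tP` (the `P`-dressing of the sandwich
`e^{l₁}e^{l₂}·P·e^{l₃}e^{l₄}`), `r₃ = (2i)⁻¹[rem l − rem l⁻¹ + t_P]`, `q₂ = (2i)⁻¹Σ_{j<k}[l_j, l_k]`, **`imC_sub_imC_sub_eq`** (`Im W − Im P
− i⁻¹Σl = q₂ + r₃` for `W = e^{l₁}e^{l₂}Pe^{l₃}e^{l₄}`; `B9Eq336CurrentBound.holonomy_sub_holonomy_invPath` BY NAME).  §3 the letters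
`ℓ₁ … ℓ₄` of `U′ = e^{iξA}U` at `p_{κν}(y)`, `letters_sum_eq` (`Σl = iξ·D¹_U A(p)`), `plaq_prodCfg_val`/`_inv_val` ((3.1) [15]),
**`imC_prodCfg_expand`**.  §4 `qFun = π∘q₂`, `rFun = π∘r₃`, **`Gπ_prodCfg_eq`**, **`F311_split`** (`𝐅 = ξ⁻¹[(D*_{U′} − D*_U)(ξ⁻²π Im ∂U′)]
+ ξ⁻³[D*_U(π q₂) + D*_U(π r₃)]`).  §5 the constants `KI`, `KQ`, `KR`, `C311` of file 4.  §6 the torus: **`sub310`** = (3.10) with body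
(`dirForm_sub310`: it IS `prodCfg`, `rfl`; `sub310_eq_expI_mul`), `current_eq_Jπ` (`rfl`), `lapCur`, `rem311`, `nabla_eq_smul_covD`
(`rfl`), **`eq311_current`** ((3.11) for `B12Eq18Current.current π ξ`), **`eq312_scale`** ((3.12), `B12Eq338CondIV.current_scale` BY NAME:
`J_ξ(U) = c³·J_{cξ}(U)`, `c = L^{j−1}η`).

HONEST SCOPE.  (a) `𝐅` is DEFINED as the remainder of (3.11); the display's content is its locality/boundedness, certified as
an explicit bound in terms of `sup|𝐀|`, `sup|∇^ξ_U𝐀|` (through `‖D¹_U𝐀‖ ≤ ξg`), `sup|∂U − 1|` and the transport size `‖U(b)^{±1}‖ ≤ ρ`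
(file 4); the set-theoretic «depends only on the values near b» statement is the sequel `B12Eq311Locality` (`F311_congr`,
`rem311_congr` over `B9Eq372Locality.stBonds`).  (b) The hypotheses are taken on ALL bonds/plaquettes of the finite lattice where the print localises
to `X` (as in every `B9Eq3…`/`B8Eq1…` kernel file); `π` is a `ℂ`-linear map with an operator bound `Cπ` commuting with the transports
`Ad(U(b)⁻¹)` (true for the projection onto `𝔤ᶜ` and `Gᶜ`-valued `U`: `B12Lemma4Models.slProj_conj`; the two models `π = id`,
`π = slProj N` are the sequel `B12Eq311Models`).  (c) The Landau-gauge replacement `D*D → Δ − P₁ + l.o.` behind `𝐅₁` of (3.13) is the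
sequel `B12Eq311Landau` (over `B11Eq135Weitzenbock`), and `𝐅₁ = 𝐅 − π(ξ⁻²𝒦𝐀)` with its bound is `B12Eq313JSlot`.  (d) Constants
explicit, not optimised ([14]'s `36d, 50d, 10d` are for `ρ = 1`, `π = id`, Hermitian `A`).  (e) Nothing here bears on Theorem 2 of [B12] or on
the continuum limit; no proof gap, no new axiom (closure `propext`/`Classical.choice`/`Quot.sound`), no named fact (`def … : Prop`).
-/

noncomputable section

open NormedSpace Complex

namespace Literature.MathematicalPhysics.QuantumFieldTheory.Balaban1983to89.B12Eq311CurrentExpansion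

open Literature.MathematicalPhysics.QuantumFieldTheory.Balaban1983to89
open Literature.MathematicalPhysics.QuantumFieldTheory.Balaban1983to89.Beta.TransportVertices
open Literature.MathematicalPhysics.QuantumFieldTheory.Balaban1983to89.Beta.AdjointTransportJets
open Literature.MathematicalPhysics.QuantumFieldTheory.Balaban1983to89.B9Eq37Insertion
open Literature.MathematicalPhysics.QuantumFieldTheory.Balaban1983to89.B9Eq39Adjoint
open Literature.MathematicalPhysics.QuantumFieldTheory.Balaban1983to89.B9Eq369Small Literature.MathematicalPhysics.QuantumFieldTheory.Balaban1983to89.B9Eq369Product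
open Literature.MathematicalPhysics.QuantumFieldTheory.Balaban1983to89.B9Eq370Expansion
open Literature.MathematicalPhysics.QuantumFieldTheory.Balaban1983to89.B9TorusCalculus

/-! ## §1  The current with the projection `π` on the abstract lattice, and (3.11) as an identity -/

section Objects

variable {𝔸 : Type*} [NormedRing 𝔸] [NormedAlgebra ℂ 𝔸] {S : Type*} {ι : Type*}
variable (T : ι → Equiv.Perm S)

/-- The plaquette function `ξ⁻² π Im V(∂p)` of (1.8) for a configuration `V` of the abstract lattice of [15] (`π` a `ℂ`-linear map,
the printed projection onto `𝔤ᶜ`; `Im W = (2i)⁻¹(W − W⁻¹)` = `B9Eq37Insertion.imC`). [cite: Balaban1987RG1, (1.8) p.261] -/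
def Gπ (π : 𝔸 →ₗ[ℂ] 𝔸) (ξ : ℝ) (V : ι → S → 𝔸ˣ) : ι → ι → S → 𝔸 :=
  fun μ ν x => (((ξ : ℂ)⁻¹) ^ 2) • π (imC (plaqU T V μ ν x))

variable [Fintype ι] [LinearOrder ι]

/-- The current (1.8) `J(V) = D^{ξ*}_V ξ⁻² π Im ∂V` on the abstract lattice (`π = id`: `B9Eq39Adjoint.J`). [cite: Balaban1987RG1, (1.8) p.261] -/
def Jπ (π : 𝔸 →ₗ[ℂ] 𝔸) (ξ : ℝ) (V : ι → S → 𝔸ˣ) : ι → S → 𝔸 := divPη T V ξ (Gπ T π ξ V)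

/-- The first-order term of (3.11): `D^{ξ*}_V π D^ξ_V 𝐀 = ξ⁻¹D*(π(ξ⁻¹D¹_V 𝐀))` (the print's `D^{ξ*}_U D^ξ_U 𝐀` for `𝔤ᶜ`-valued
`𝐀` and `π` the projection onto `𝔤ᶜ` commuting with the transports). [cite: Balaban1987RG1, (3.11) p.272] -/
def lapπ (π : 𝔸 →ₗ[ℂ] 𝔸) (ξ : ℝ) (V : ι → S → 𝔸ˣ) (A : ι → S → 𝔸) : ι → S → 𝔸 :=
  divPη T V ξ (fun μ ν x => π (curlη T V ξ A μ ν x))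

/-- For `π = id` the current is the current (3.11) of [15], `B9Eq39Adjoint.J`. [cite: Balaban1987RG1, (1.8) p.261] -/
theorem Jπ_id (ξ : ℝ) (V : ι → S → 𝔸ˣ) : Jπ T LinearMap.id ξ V = J T V ξ := rfl

variable [CompleteSpace 𝔸]

/-- **The remainder `𝐅(V, 𝐀)` of (3.11)**: `𝐅(V, 𝐀) := J(e^{iξ𝐀}V) − J(V) − D^{ξ*}_V π D^ξ_V 𝐀` (`e^{iξ𝐀}V` =
`B9Eq39Adjoint.prodCfg V ξ 𝐀`). [cite: Balaban1987RG1, (3.11) p.272] -/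
def F311 (π : 𝔸 →ₗ[ℂ] 𝔸) (ξ : ℝ) (V : ι → S → 𝔸ˣ) (A : ι → S → 𝔸) : ι → S → 𝔸 :=
  fun μ x => Jπ T π ξ (prodCfg V ξ A) μ x - Jπ T π ξ V μ x - lapπ T π ξ V A μ x

/-- **[B12 (3.11)]**: `D^{ξ*}_{exp iξ𝐀V} ξ⁻²π Im ∂(exp iξ𝐀V) = D^{ξ*}_V ξ⁻²π Im ∂V + D^{ξ*}_V π D^ξ_V 𝐀 + 𝐅(V, 𝐀)` — with
`𝐅` DEFINED as the remainder this is an identity; the content of the display, «𝐅 is a local operator depending on V, ∂V, 𝐀,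
∇^ξ_V𝐀 only», is the BOUND `B12Eq311RemainderBound.norm_F311_le` in terms of exactly these four quantities.
[cite: Balaban1987RG1, (3.11) p.272] -/
theorem eq311 (π : 𝔸 →ₗ[ℂ] 𝔸) (ξ : ℝ) (V : ι → S → 𝔸ˣ) (A : ι → S → 𝔸) (μ : ι) (x : S) :
    Jπ T π ξ (prodCfg V ξ A) μ x = Jπ T π ξ V μ x + lapπ T π ξ V A μ x + F311 T π ξ V A μ x := by
  simp only [F311]; abel

end Objects

/-! ## §2  One plaquette: the dressing `t_P`, the remainder `r₃`, the second-order term `q₂`, and the expansion of `Im` -/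

section PlaquetteAlgebra

variable {𝔸 : Type*} [NormedRing 𝔸] [NormedAlgebra ℂ 𝔸] [CompleteSpace 𝔸]

/-- The `P`-dressed correction of the sandwich `E₁₂·P·E₃₄` relative to `E₁₂E₃₄` and of its inverse: with `E₁₂ = e^{l₁}e^{l₂}`,
`E₃₄ = e^{l₃}e^{l₄}`, `E′₄₃ = e^{−l₄}e^{−l₃}`, `E′₂₁ = e^{−l₂}e^{−l₁}`,
`t_P = [(E₁₂ − 1)(P − 1)E₃₄ + (P − 1)(E₃₄ − 1)] − [(E′₄₃ − 1)(P⁻¹ − 1)E′₂₁ + (P⁻¹ − 1)(E′₂₁ − 1)]` — every term carries a factor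
`P − 1` or `P⁻¹ − 1` AND a factor `E − 1` (first order in the letters) — the first two terms of [14] (1.43) and their mirror
for the reversed contour. [cite: Balaban1985RegularSpaces, (1.43) p.83] -/
def tP (P : 𝔸ˣ) (l₁ l₂ l₃ l₄ : 𝔸) : 𝔸 :=
  ((holonomy [l₁, l₂] - 1) * ((P : 𝔸) - 1) * holonomy [l₃, l₄] + ((P : 𝔸) - 1) * (holonomy [l₃, l₄] - 1))
    - ((holonomy [-l₄, -l₃] - 1) * (((P⁻¹ : 𝔸ˣ) : 𝔸) - 1) * holonomy [-l₂, -l₁]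
        + (((P⁻¹ : 𝔸ˣ) : 𝔸) - 1) * (holonomy [-l₂, -l₁] - 1))

/-- The third-order-and-dressing remainder of the expansion of `Im`:
`r₃ = (2i)⁻¹·[rem l − rem l⁻¹ + t_P]`, `l = [l₁, l₂, l₃, l₄]` (`rem` = the third-order Taylor remainder of the ordered product
`e^{l₁}e^{l₂}e^{l₃}e^{l₄}`, `B9Eq37Insertion.rem`; `l⁻¹ = invPath l = [−l₄, −l₃, −l₂, −l₁]`) — the remainder of [14] (1.47)–(1.48)
plus the dressing. [cite: Balaban1985RegularSpaces, (1.48) p.84] -/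
def r₃ (P : 𝔸ˣ) (l₁ l₂ l₃ l₄ : 𝔸) : 𝔸 :=
  (2 * I)⁻¹ • (rem [l₁, l₂, l₃, l₄] - rem (invPath [l₁, l₂, l₃, l₄]) + tP P l₁ l₂ l₃ l₄)

/-- The second-order term: `q₂ = (2i)⁻¹·Σ_{j<k}[l_j, l_k]` (`Beta.TransportVertices.commSum`) — the commutator part «{…}» of
[14] (1.49)'s `V₂` (its symmetric part `η²((D^η_{U₀}A)(p))²` cancels in `Im`). [cite: Balaban1985RegularSpaces, (1.49) p.85] -/
def q₂ (l₁ l₂ l₃ l₄ : 𝔸) : 𝔸 := (2 * I)⁻¹ • commSum [l₁, l₂, l₃, l₄]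

/-- `(2i)⁻¹·2 = i⁻¹`. [folklore] -/
private theorem two_I_inv_mul_two : (2 * I : ℂ)⁻¹ * 2 = I⁻¹ := by
  field_simp

omit [CompleteSpace 𝔸] in
/-- **THE EXPANSION OF `Im` OF A SANDWICHED PLAQUETTE TO SECOND ORDER.**  If `W = e^{l₁}e^{l₂}·P·e^{l₃}e^{l₄}` and
`W⁻¹ = e^{−l₄}e^{−l₃}·P⁻¹·e^{−l₂}e^{−l₁}` (the plaquette variable of `e^{iξA}U` and its inverse, `B9Eq369Product.plaqU_prodCfg_val`),
then `Im W − Im P − i⁻¹Σ_j l_j = q₂ + r₃` with `q₂ = (2i)⁻¹Σ_{j<k}[l_j, l_k]` and `r₃` third order in the letters plus first order times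
`|P − 1|` — the expansion [14] (1.47) of the plaquette variable to second order, for `Im` and an exact background.
[cite: Balaban1985RegularSpaces, (1.47) p.84] -/
theorem imC_sub_imC_sub_eq (P W : 𝔸ˣ) (l₁ l₂ l₃ l₄ : 𝔸)
    (hW : (W : 𝔸) = exp l₁ * exp l₂ * (P : 𝔸) * exp l₃ * exp l₄)
    (hWi : ((W⁻¹ : 𝔸ˣ) : 𝔸) = exp (-l₄) * exp (-l₃) * ((P⁻¹ : 𝔸ˣ) : 𝔸) * exp (-l₂) * exp (-l₁)) :
    imC W - imC P - I⁻¹ • [l₁, l₂, l₃, l₄].sum = q₂ l₁ l₂ l₃ l₄ + r₃ P l₁ l₂ l₃ l₄ := by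
  set l : List 𝔸 := [l₁, l₂, l₃, l₄] with hl
  have hX1 : (W : 𝔸) - P = (holonomy l - 1)
      + ((holonomy [l₁, l₂] - 1) * ((P : 𝔸) - 1) * holonomy [l₃, l₄] + ((P : 𝔸) - 1) * (holonomy [l₃, l₄] - 1)) := by
    rw [hW, hl]
    simp only [holonomy_cons, holonomy_nil, mul_one]
    noncomm_ring
  have hinv : invPath l = [-l₄, -l₃, -l₂, -l₁] := by simp [hl, invPath]
  have hX2 : ((W⁻¹ : 𝔸ˣ) : 𝔸) - ((P⁻¹ : 𝔸ˣ) : 𝔸) = (holonomy (invPath l) - 1)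
      + ((holonomy [-l₄, -l₃] - 1) * (((P⁻¹ : 𝔸ˣ) : 𝔸) - 1) * holonomy [-l₂, -l₁]
          + (((P⁻¹ : 𝔸ˣ) : 𝔸) - 1) * (holonomy [-l₂, -l₁] - 1)) := by
    rw [hWi, hinv]
    simp only [holonomy_cons, holonomy_nil, mul_one]
    noncomm_ring
  have key : ((W : 𝔸) - ((W⁻¹ : 𝔸ˣ) : 𝔸)) - ((P : 𝔸) - ((P⁻¹ : 𝔸ˣ) : 𝔸))
      = (2 : ℂ) • l.sum + commSum l + (rem l - rem (invPath l) + tP P l₁ l₂ l₃ l₄) := by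
    calc ((W : 𝔸) - ((W⁻¹ : 𝔸ˣ) : 𝔸)) - ((P : 𝔸) - ((P⁻¹ : 𝔸ˣ) : 𝔸))
        = ((W : 𝔸) - P) - (((W⁻¹ : 𝔸ˣ) : 𝔸) - ((P⁻¹ : 𝔸ˣ) : 𝔸)) := by abel
      _ = (holonomy l - holonomy (invPath l)) + tP P l₁ l₂ l₃ l₄ := by rw [hX1, hX2, tP]; abel
      _ = _ := by rw [B9Eq336CurrentBound.holonomy_sub_holonomy_invPath]; abel
  rw [imC, imC, ← smul_sub, key, q₂, r₃, ← hl, smul_add, smul_add, smul_smul, two_I_inv_mul_two]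
  abel

end PlaquetteAlgebra

/-! ## §3  The four letters of `U′ = e^{iξA}U` at a plaquette -/

section Letters

variable {𝔸 : Type*} [NormedRing 𝔸] [NormedAlgebra ℂ 𝔸] [CompleteSpace 𝔸] {S : Type*} {ι : Type*}
variable (T : ι → Equiv.Perm S) (U : ι → S → 𝔸ˣ)

/-- The entering near letter `iξA_κ(y)` (the letters `A′(b)`, `b ⊂ ∂p`, of [15] (3.2), at parameter `ξ`).
[cite: Balaban1985BackgroundPropagators, (3.2) p.390] -/
def ℓ₁ (ξ : ℝ) (A : ι → S → 𝔸) (κ _ν : ι) (y : S) : 𝔸 := (I * ξ : ℂ) • A κ y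

/-- The entering far letter `R(U_κ(y))iξA_ν(y+e_κ)`. [cite: Balaban1985BackgroundPropagators, (3.2) p.390] -/
def ℓ₂ (ξ : ℝ) (A : ι → S → 𝔸) (κ ν : ι) (y : S) : 𝔸 := R (U κ y) ((I * ξ : ℂ) • A ν (T κ y))

/-- The leaving far letter `−R(U_ν(y))iξA_κ(y+e_ν)` ((3.5): reversed bond). [cite: Balaban1985BackgroundPropagators, (3.5) p.391] -/
def ℓ₃ (ξ : ℝ) (A : ι → S → 𝔸) (κ ν : ι) (y : S) : 𝔸 := -(R (U ν y) ((I * ξ : ℂ) • A κ (T ν y)))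

/-- The leaving near letter `−iξA_ν(y)`. [cite: Balaban1985BackgroundPropagators, (3.5) p.391] -/
def ℓ₄ (ξ : ℝ) (A : ι → S → 𝔸) (_κ ν : ι) (y : S) : 𝔸 := -((I * ξ : ℂ) • A ν y)

omit [CompleteSpace 𝔸] in
/-- The letter sum is `iξ` times the covariant curl: `Σ_j l_j = iξ·(D¹_U A)(p)` (`= iξ²(D^ξ_U A)(p)`). [folklore]
[cite: Balaban1985BackgroundPropagators, (3.4) p.391] -/
theorem letters_sum_eq (ξ : ℝ) (A : ι → S → 𝔸) (κ ν : ι) (y : S) :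
    [ℓ₁ ξ A κ ν y, ℓ₂ T U ξ A κ ν y, ℓ₃ T U ξ A κ ν y, ℓ₄ ξ A κ ν y].sum = (I * ξ : ℂ) • curl T U A κ ν y := by
  simp only [List.sum_cons, List.sum_nil, add_zero, ℓ₁, ℓ₂, ℓ₃, ℓ₄, R_smul, curl, covD, smul_sub]
  abel

/-- **(3.1) for `U′ = e^{iξA}U`**: `(U′)(∂p) = e^{l₁}e^{l₂}·U(∂p)·e^{l₃}e^{l₄}` (`B9Eq369Product.plaqU_prodCfg_val`). [folklore]
[cite: Balaban1985BackgroundPropagators, (3.1) p.390] -/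
theorem plaq_prodCfg_val (ξ : ℝ) (A : ι → S → 𝔸) (κ ν : ι) (y : S) :
    (plaqU T (prodCfg U ξ A) κ ν y : 𝔸)
      = exp (ℓ₁ ξ A κ ν y) * exp (ℓ₂ T U ξ A κ ν y) * (plaqU T U κ ν y : 𝔸) * exp (ℓ₃ T U ξ A κ ν y)
        * exp (ℓ₄ ξ A κ ν y) :=
  plaqU_prodCfg_val T U ξ A κ ν y

/-- … and the reversed contour `(U′)(∂p)⁻¹ = e^{−l₄}e^{−l₃}·U(∂p)⁻¹·e^{−l₂}e^{−l₁}`. [folklore]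
[cite: Balaban1985BackgroundPropagators, (3.5) p.391] -/
theorem plaq_prodCfg_inv_val (ξ : ℝ) (A : ι → S → 𝔸) (κ ν : ι) (y : S) :
    (((plaqU T (prodCfg U ξ A) κ ν y)⁻¹ : 𝔸ˣ) : 𝔸)
      = exp (-ℓ₄ ξ A κ ν y) * exp (-ℓ₃ T U ξ A κ ν y) * (((plaqU T U κ ν y)⁻¹ : 𝔸ˣ) : 𝔸)
        * exp (-ℓ₂ T U ξ A κ ν y) * exp (-ℓ₁ ξ A κ ν y) := by
  rw [plaqU_prodCfg_inv_val]; simp only [ℓ₁, ℓ₂, ℓ₃, ℓ₄, neg_neg]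

/-- **`Im(U′)(∂p) − Im U(∂p) − ξ·(D¹_U A)(p) = q₂ + r₃`** at every plaquette (`ξ·D¹ = ξ²D^ξ`). [folklore]
[cite: Balaban1987RG1, (3.11) p.272] -/
theorem imC_prodCfg_expand (ξ : ℝ) (A : ι → S → 𝔸) (κ ν : ι) (y : S) :
    imC (plaqU T (prodCfg U ξ A) κ ν y) - imC (plaqU T U κ ν y) - (ξ : ℂ) • curl T U A κ ν y
      = q₂ (ℓ₁ ξ A κ ν y) (ℓ₂ T U ξ A κ ν y) (ℓ₃ T U ξ A κ ν y) (ℓ₄ ξ A κ ν y)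
        + r₃ (plaqU T U κ ν y) (ℓ₁ ξ A κ ν y) (ℓ₂ T U ξ A κ ν y) (ℓ₃ T U ξ A κ ν y) (ℓ₄ ξ A κ ν y) := by
  rw [← imC_sub_imC_sub_eq _ _ _ _ _ _ (plaq_prodCfg_val T U ξ A κ ν y) (plaq_prodCfg_inv_val T U ξ A κ ν y),
    letters_sum_eq, smul_smul]
  congr 2
  by_cases hI : (I : ℂ) = 0
  · exact absurd hI I_ne_zero
  · field_simp

end Letters

/-! ## §4  The plaquette functions `π∘q₂`, `π∘r₃`, the expansion of `ξ⁻²π Im ∂U′`, and the decomposition of `𝐅` -/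

section Main

variable {𝔸 : Type*} [NormedRing 𝔸] [NormedAlgebra ℂ 𝔸] [CompleteSpace 𝔸] {S : Type*} {ι : Type*} [Fintype ι] [LinearOrder ι]
variable (T : ι → Equiv.Perm S) (U : ι → S → 𝔸ˣ)
variable {ρ a g ε ξ Cπ : ℝ} {A : ι → S → 𝔸} {π : 𝔸 →ₗ[ℂ] 𝔸}

/-- The second-order plaquette function `π∘q₂` of the letters of `(U, A)`. [cite: Balaban1987RG1, (3.11) p.272] -/
def qFun (π : 𝔸 →ₗ[ℂ] 𝔸) (ξ : ℝ) (A : ι → S → 𝔸) : ι → ι → S → 𝔸 :=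
  fun κ ν z => π (q₂ (ℓ₁ ξ A κ ν z) (ℓ₂ T U ξ A κ ν z) (ℓ₃ T U ξ A κ ν z) (ℓ₄ ξ A κ ν z))

/-- The remainder plaquette function `π∘r₃` of the letters of `(U, A)` and the background plaquette `U(∂p)`.
[cite: Balaban1987RG1, (3.11) p.272] -/
def rFun (π : 𝔸 →ₗ[ℂ] 𝔸) (ξ : ℝ) (A : ι → S → 𝔸) : ι → ι → S → 𝔸 :=
  fun κ ν z => π (r₃ (plaqU T U κ ν z) (ℓ₁ ξ A κ ν z) (ℓ₂ T U ξ A κ ν z) (ℓ₃ T U ξ A κ ν z) (ℓ₄ ξ A κ ν z))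

omit [Fintype ι] [LinearOrder ι] in
/-- **THE PLAQUETTE FUNCTION OF `U′`, EXPANDED**: `ξ⁻²π Im U′(∂p) = ξ⁻²π Im U(∂p) + π(D^ξ_U A)(p) + ξ⁻²(π q₂ + π r₃)`. [folklore]
[cite: Balaban1987RG1, (3.11) p.272] -/
theorem Gπ_prodCfg_eq (hξ : ξ ≠ 0) (π : 𝔸 →ₗ[ℂ] 𝔸) (A : ι → S → 𝔸) :
    Gπ T π ξ (prodCfg U ξ A)
      = Gπ T π ξ U + (fun κ ν z => π (curlη T U ξ A κ ν z)) + (((ξ : ℂ)⁻¹) ^ 2) • (qFun T U π ξ A + rFun T U π ξ A) := by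
  have hξ' : (ξ : ℂ) ≠ 0 := Complex.ofReal_ne_zero.mpr hξ
  funext κ ν z
  simp only [Pi.add_apply, Pi.smul_apply, Gπ, qFun, rFun, curlη]
  have e := imC_prodCfg_expand T U ξ A κ ν z
  rw [show imC (plaqU T (prodCfg U ξ A) κ ν z)
      = imC (plaqU T U κ ν z) + (ξ : ℂ) • curl T U A κ ν z
        + (q₂ (ℓ₁ ξ A κ ν z) (ℓ₂ T U ξ A κ ν z) (ℓ₃ T U ξ A κ ν z) (ℓ₄ ξ A κ ν z)
          + r₃ (plaqU T U κ ν z) (ℓ₁ ξ A κ ν z) (ℓ₂ T U ξ A κ ν z) (ℓ₃ T U ξ A κ ν z) (ℓ₄ ξ A κ ν z)) by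
      rw [← e]; abel]
  rw [map_add, map_add, map_add, map_smul, map_smul, smul_add, smul_add, smul_smul,
    show ((ξ : ℂ)⁻¹) ^ 2 * (ξ : ℂ) = (ξ : ℂ)⁻¹ by field_simp]

/-- **THE DECOMPOSITION OF `𝐅`**: `𝐅 = ξ⁻¹[(D*_{U′} − D*_U)(ξ⁻²π Im ∂U′)] + ξ⁻³[D*_U(π q₂) + D*_U(π r₃)]` — change of transport plus
the divergence of the second-order and remainder plaquette functions. [folklore] [cite: Balaban1987RG1, (3.11) p.272] -/
theorem F311_split (hξ : ξ ≠ 0) (π : 𝔸 →ₗ[ℂ] 𝔸) (A : ι → S → 𝔸) (μ : ι) (x : S) :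
    F311 T π ξ U A μ x
      = ((ξ : ℂ)⁻¹) • (divP T (prodCfg U ξ A) (Gπ T π ξ (prodCfg U ξ A)) μ x - divP T U (Gπ T π ξ (prodCfg U ξ A)) μ x)
        + (((ξ : ℂ)⁻¹) ^ 3) • (divP T U (qFun T U π ξ A) μ x + divP T U (rFun T U π ξ A) μ x) := by
  have hdiv : divP T U (Gπ T π ξ (prodCfg U ξ A)) μ x
      = divP T U (Gπ T π ξ U) μ x + divP T U (fun κ ν z => π (curlη T U ξ A κ ν z)) μ x
        + (((ξ : ℂ)⁻¹) ^ 2) • (divP T U (qFun T U π ξ A) μ x + divP T U (rFun T U π ξ A) μ x) := by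
    rw [Gπ_prodCfg_eq T U hξ, B9Eq310Hermitian.divP_add, B9Eq310Hermitian.divP_add, divP_smul, B9Eq310Hermitian.divP_add]
  simp only [F311, Jπ, lapπ, divPη]
  rw [hdiv]
  simp only [smul_sub, smul_add, smul_smul]
  rw [show (ξ : ℂ)⁻¹ * ((ξ : ℂ)⁻¹) ^ 2 = ((ξ : ℂ)⁻¹) ^ 3 by ring]
  abel

end Main

/-! ## §5  The absolute constants of the linear bound (file 4) -/

section Linear

variable {𝔸 : Type*} [NormedRing 𝔸] [NormedAlgebra ℂ 𝔸] [CompleteSpace 𝔸] {S : Type*} {ι : Type*} [Fintype ι] [LinearOrder ι]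
variable (T : ι → Equiv.Perm S) (U : ι → S → 𝔸ˣ)
variable {ρ ξ Cπ α₀ α₂ : ℝ} {A : ι → S → 𝔸} {π : 𝔸 →ₗ[ℂ] 𝔸}

/-- The three pieces of OUR absolute constant `C_F(ρ)` (change of transport, second order, remainder; [14] (1.54) prints `10d`, `36d`, `50d`
for `ρ = 1`, `π = id`, Hermitian `A` — not these). [cite: Balaban1985RegularSpaces, (1.54) p.85] -/
def KI (ρ : ℝ) : ℝ :=
  ρ ^ 4 * Real.exp (2 * ρ ^ 2) * (1 + Real.exp 4 * ρ ^ 4)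
    * (2 + 1 / 2 * (2 * (1 + ρ ^ 2)) ^ 2 * Real.exp (2 * (1 + ρ ^ 2)) + Real.exp (2 * (1 + ρ ^ 2)))

/-- (second piece of OUR constant; cf. [14] (1.53)'s `32d`). [cite: Balaban1985RegularSpaces, (1.53) p.85] -/
def KQ (ρ : ℝ) : ℝ := 2 * (1 + ρ ^ 2) ^ 2 * (3 * ρ ^ 2 + 1)

/-- (third piece of OUR constant; cf. [14] (1.44), (1.48)). [cite: Balaban1985RegularSpaces, (1.54) p.85] -/
def KR (ρ : ℝ) : ℝ :=
  2 * (1 + ρ ^ 2) ^ 2 * ((2 * (1 + ρ ^ 2)) ^ 2 / 6 * Real.exp (2 * (1 + ρ ^ 2))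
    + Real.exp (2 * (2 * (1 + ρ ^ 2))) * (1 + ρ ^ 4))

/-- The absolute constant `C_F(ρ) = K_I + K_q + K_r` of the linear bound (a polynomial in `ρ` and exponentials of `ρ²`; `ρ` = the
bound on the bond variables `‖U(b)^{±1}‖`, `ρ = 1` for a unitary background in an operator norm); «there exists a constant α₂,
depending on α₀ and on some absolute constants» (p. 272) — this is ours, not a printed value. [cite: Balaban1987RG1, (3.14) p.272] -/
def C311 (ρ : ℝ) : ℝ := KI ρ + KQ ρ + KR ρ

end Linear

/-! ## §6  The torus: (3.10), (3.11) for `B12Eq18Current.current`, (3.12) -/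

section Torus

variable {P : Params} {i : ℕ} {𝔸 : Type*} [NormedRing 𝔸] [NormedAlgebra ℂ 𝔸] [CompleteSpace 𝔸]

/-- **(3.10), the substitution `U′ = exp iξ𝐀·U`** — bondwise `U′(b) = e^{iξ𝐀(b)}U(b)` (print: «U′ = exp iξ𝐀U_{k+1}, 𝐉′ =
D^{ξ*}_{exp iξ𝐀U_{k+1}} ξ⁻²π Im ∂ exp iξ𝐀U_{k+1}»; here for an arbitrary configuration `U` in the rôle of `U_{k+1}`, as the print
continues «more generally, for any regular configuration U»). [cite: Balaban1987RG1, (3.10) p.272] -/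
def sub310 (ξ : ℝ) (A : PBond P i → 𝔸) (U : PBond P i → 𝔸ˣ) : PBond P i → 𝔸ˣ :=
  fun b => fluct ξ (B12Eq18Current.dirForm A) b.dir b.src * U b

/-- (3.10) read through the dictionary of `B12Eq18Current`: `U′` IS the product configuration `prodCfg` of the calculus of [15]
on the torus datum. [cite: Balaban1987RG1, (3.10) p.272] -/
theorem dirForm_sub310 (ξ : ℝ) (A : PBond P i → 𝔸) (U : PBond P i → 𝔸ˣ) :
    B12Eq18Current.dirForm (sub310 ξ A U) = prodCfg (B12Eq18Current.dirForm U) ξ (B12Eq18Current.dirForm A) := rfl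

/-- The bond variable of (3.10): `U′(b) = e^{iξ𝐀(b)}·U(b)`. [cite: Balaban1987RG1, (3.10) p.272] -/
theorem val_sub310 (ξ : ℝ) (A : PBond P i → 𝔸) (U : PBond P i → 𝔸ˣ) (b : PBond P i) :
    (sub310 ξ A U b : 𝔸) = exp ((I * ξ : ℂ) • A b) * (U b : 𝔸) := by
  rw [sub310, Units.val_mul, val_fluct]; rfl

/-- (3.10) in the letters of `B12RegularSpaces111`: `U′(b) = (exp iξ𝐀(b))·U(b)` with `B12RegularSpaces111.expI`.
[cite: Balaban1987RG1, (3.10) p.272] -/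
theorem sub310_eq_expI_mul (ξ : ℝ) (A : PBond P i → 𝔸) (U : PBond P i → 𝔸ˣ) (b : PBond P i) :
    sub310 ξ A U b = B12RegularSpaces111.expI ξ (A b) * U b := by
  ext
  rw [val_sub310, Units.val_mul, B12RegularSpaces111.expI, Beta.BackgroundVertices.val_expUnit]

omit [CompleteSpace 𝔸] in
/-- The current (1.8) of `B12Eq18Current` IS `Jπ` on the torus datum. [cite: Balaban1987RG1, (1.8) p.261] -/
theorem current_eq_Jπ (π : 𝔸 →ₗ[ℂ] 𝔸) (ξ : ℝ) (V : PBond P i → 𝔸ˣ) (b : PBond P i) :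
    B12Eq18Current.current π ξ V b = Jπ (torusT P i) π ξ (B12Eq18Current.dirForm V) b.dir b.src := rfl

/-- **The first-order term of (3.11), `D^{ξ*}_U π D^ξ_U 𝐀`**, as a bond function on the torus (`= D^{ξ*}_U D^ξ_U 𝐀` of the print for
`𝔤ᶜ`-valued `𝐀` and `π` the projection onto `𝔤ᶜ` commuting with the adjoint action). [cite: Balaban1987RG1, (3.11) p.272] -/
def lapCur (π : 𝔸 →ₗ[ℂ] 𝔸) (ξ : ℝ) (U : PBond P i → 𝔸ˣ) (A : PBond P i → 𝔸) : PBond P i → 𝔸 :=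
  fun b => lapπ (torusT P i) π ξ (B12Eq18Current.dirForm U) (B12Eq18Current.dirForm A) b.dir b.src

/-- **The remainder `𝐅(U, 𝐀)` of (3.11)** as a bond function on the torus. [cite: Balaban1987RG1, (3.11) p.272] -/
def rem311 (π : 𝔸 →ₗ[ℂ] 𝔸) (ξ : ℝ) (U : PBond P i → 𝔸ˣ) (A : PBond P i → 𝔸) : PBond P i → 𝔸 :=
  fun b => F311 (torusT P i) π ξ (B12Eq18Current.dirForm U) (B12Eq18Current.dirForm A) b.dir b.src

omit [CompleteSpace 𝔸] in
/-- The `ξ`-covariant derivative `∇^ξ_U` of `B12RegularSpaces111` IS `ξ⁻¹·D¹_U` of the calculus of [15] on the torus datum.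
[cite: Balaban1987RG1, (1.13) p.262] -/
theorem nabla_eq_smul_covD (ξ : ℝ) (U : PBond P i → 𝔸ˣ) (μ ν : Fin P.d) (A : PBond P i → 𝔸) (x : Site P i) :
    B12RegularSpaces111.nabla ξ U μ (fun y => A ⟨y, ν⟩) x
      = ((ξ : ℂ)⁻¹) • covD (torusT P i) (B12Eq18Current.dirForm U) μ (B12Eq18Current.dirForm A ν) x := rfl

/-- **[B12 (3.11)] for the concrete current (1.8)**: `J(exp iξ𝐀·U) = J(U) + D^{ξ*}_U π D^ξ_U 𝐀 + 𝐅(U, 𝐀)` on the torus, for every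
configuration `U`, every `𝐀`, every `ℂ`-linear `π`. [cite: Balaban1987RG1, (3.11) p.272] -/
theorem eq311_current (π : 𝔸 →ₗ[ℂ] 𝔸) (ξ : ℝ) (U : PBond P i → 𝔸ˣ) (A : PBond P i → 𝔸) (b : PBond P i) :
    B12Eq18Current.current π ξ (sub310 ξ A U) b
      = B12Eq18Current.current π ξ U b + lapCur π ξ U A b + rem311 π ξ U A b := by
  rw [current_eq_Jπ, current_eq_Jπ, dirForm_sub310]
  exact eq311 _ π ξ _ _ _ _

omit [CompleteSpace 𝔸] in
/-- **[B12 (3.12)]** «D^{ξ*}_{U_{k+1}} ξ⁻²π Im ∂U_{k+1} = (L^{j−1}η)³ J_{k+1}»: the current (1.8) of a configuration read at the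
parameter `ξ` is `c³` times its current at the parameter `cξ` (`c = L^{j−1}η`, `cξ` = the own parameter of `U_{k+1}`;
`B12Eq338CondIV.current_scale` BY NAME). [cite: Balaban1987RG1, (3.12) p.272] -/
theorem eq312_scale (π : 𝔸 →ₗ[ℂ] 𝔸) {ξ c : ℝ} (hξ : ξ ≠ 0) (hc : c ≠ 0) (U : PBond P i → 𝔸ˣ) (b : PBond P i) :
    B12Eq18Current.current π ξ U b = ((c : ℂ) ^ 3) • B12Eq18Current.current π (c * ξ) U b := by
  rw [B12Eq338CondIV.current_scale π (mul_ne_zero hc hξ) U b]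
  congr 2
  have hξ' : (ξ : ℂ) ≠ 0 := Complex.ofReal_ne_zero.mpr hξ
  push_cast
  field_simp

end Torus

end Literature.MathematicalPhysics.QuantumFieldTheory.Balaban1983to89.B12Eq311CurrentExpansion
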